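import Summits.QuantumFields.YangMills.Theorems.BalabanUVNodesN15BackwardShift
import Summits.QuantumFields.BalabanUV.T4Continuum.Support.BlockPairingGeometry
import HarnessLib

/-!
# Route «BalabanUVNodes» (K3′), node N15 = NE2, -a lane, part 34: THE CONFORMING TWO-GRID TRANSPORT OF THE b05 TORUS MODEL — translations as a
# group-algebra action, box filter `A_κ`, partial sums `B̃_κ`, smoothed King prolongation `P̂₂ = (Π_νA_ν²)P`, and the EXACT intertwinings
# `∂′_κA_κP = P∂_κ`, `∂′_κP̂₂ = (A_κΠ_{ν≠κ}A_ν²)P∂_κ`, `P − P̂₂ = Σ_ν∂′_νH⁰_ν` with `‖H⁰_νλ‖ ≤ η‖λ‖`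

Cell `pub-ymgap`, seat `pub-ymgap-dag-n15-a` (KNIT-BY-NAME, g11; D-0062; chair R424 venue; `bears_on: R4∕N15`); `--supports stmt-QuantumFields-19910 --as helper` (K1‴ lane per dag-lead WORDS-133).
Door (iv) of `HOME/pub-ymgap-dag-n15-a/DOOR-IV-PLAN.md` §7.1 (route R, file R1): the NE2⁰ operator layer of the FULL `U ≡ 1` propagator through
`T4EtaRateDefect.idef_inv` (`𝔇(G′,G) = G′τ₁ − τ₂G = −G′·(Δ′τ₂ − τ₁Δ)·G`) needs an OUTPUT transport `τ₂` whose fine Laplacian is not a block-face dipole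
layer; King's piecewise-constant `P = pull kingPrV` (parts 15–33) is not energy-conforming.  This file supplies the conforming transport and its exact
algebra.  Imports BY NAME (nothing modified): n15-c's `…N15BackwardShift` (`kingPr`∕`kingPrV`, `pull`, floor dichotomy) and
`BalabanUV/T4Continuum/Support/BlockPairingGeometry` (for the `rfl` dictionary `kingPr = par`, `kingPrV = parT` of §5).
EXISTING COUSINS (cited, not restated; dag-lead DEDUP-243): the pointwise box filter ∕ twice-filtered prolongation for `E`-valued fields over a normed
`ℂ`-space — `RegularTowerSubdivision.boxAvg`, `subdiv = boxAvg ∘ boxAvg ∘ pullback`, `boxAvg_tau_sub`, `subdiv_tau_sub`,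
`RegularTowerSubdivisionSecond.subdiv_tau_tau_sub` (cell `pub-balaban`) — and for `ℤ^d`-periodic fields in `ℓ²` — `NE3LineAverage.lineAvg`,
`dPot_lineAvg_self`, `NE3LineAverageSmoothing.boxAvg` (cell `pub-balaban-gaps`).  Neither is consumable by the N15 lineage, whose currency is ℝ-LINEAR
MAPS on real 1-forms `Tor (fine n M) × Fin (d+1) → ℝ` composed with `idef`, `pull kingPrV`, `B11SectG.HasMaj` (`ℝ` is no `ℂ`-module).  NEW here:
(a) OPERATOR form — every translation-built operator is the image of a SYMBOL of the commutative group algebra `ℝ[T_{η′}]` under ONE algebra hom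
`symbOp` (§1), so commutation ∕ telescoping ∕ peeling is `CommRing` algebra on symbols (§2) moved by `map_mul`; (b) the intertwinings as identities
of linear maps against `pull (kingPrV L k m M)` (§5), the form `idef_inv`∕`idef_comp` consume; (c) the swap cost `P − P̂₂` in DIVERGENCE form with
explicit swap symbols `h⁰_ν` and the bound `‖H⁰_νλ‖ ≤ η‖λ‖` (§2, §4–§5) — the shape [B5] (1.110) «G∇*J» consumes in the sequel R3.
CONTENTS.  §1 `tshiftV`, `transRep`, **`symbOp`** (`AddMonoidAlgebra.lift`), `symbOp_single(_apply)`.  §2 symbols `sT` (`s_κ`), `sA` (`a_κ = R⁻¹Σ_{j<R}s_κ^j`),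
`sBt` (`b̃_κ = Σ_{j<R}Σ_{i<j}s_κ^i`), `sD` (`c(s_κ−1)`), `sSm` (`Π_νa_ν²`), `sH` (`h⁰_ν`); `sT_pow`, `sT_sub_one_mul_sum`, **`sD_mul_sA`** (`c(s−1)a = cR⁻¹(s^R−1)`),
`one_sub_sA`, `one_sub_sA_sq`, **`one_sub_sSm`** (`1 − Π_νa_ν² = Σ_νc(s_ν−1)h⁰_ν`), `sD_mul_sSm`.  §3 pointwise forms `symbOp_sT(_pow)_apply`, `symbOp_sA_apply`,
`symbOp_sD_apply` (the site action of `B5Prop11Plancherel.fdiff` at `c = η⁻¹`).  §5 `floorMap_add_smul_unitVec`, `kingPr_add_smul_unitVec`, `kingPr_eq_par`∕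
`kingPrV_eq_parT` (`rfl`), `symbOp_sT_pow_comp_pull`, ★ **`symbOp_sD_sA_comp_pull`** (`∂′_κA_κP = P∂_κ`), ★ **`symbOp_sD_sSm_comp_pull`**, ★ **`pull_sub_sSm_comp_pull`**.
§4 `norm_tshiftV_le`, `norm_pull_le`, `norm_symbOp_sT_pow_le`, `norm_symbOp_sA_le`, `norm_symbOp_one_add_sA_le`, `sum_range_cast_eq`,
`norm_symbOp_sBt_le`, `norm_symbOp_prod_sA_sq_le`, **`norm_symbOp_sH_le`** (`≤ (R−1)∕c·‖f‖`), ★ **`norm_symbOp_sH_pull_le`** (`c = L^kL^m`, `R = L^m`: `≤ L^{−k}‖λ‖`).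
Plumbing defs are DATA (six symbols, one representation, one algebra hom; no `Prop`-valued def); every theorem is [folklore] lattice algebra.
HONEST FRAMING ∕ LIMITS.  Finite-dimensional lattice algebra and sup-norm bookkeeping on finite tori; NO estimate of [B5]∕[B9]; nothing with a
background; NOT the multiscale `𝔅`, NOT Node 00; the consistency operator `Δ′P̂₂ − PΔ` and the (3.42) entries of `G₀ = (Δ + aQ*Q)⁻¹` are the sequels
R2∕R3, NOT here.  Count-neutral (typed 28∕28 · discharged 5∕28 unchanged); NOT a discharge of N15 (object-bound; NE2⁺ NOT PRINTED); `U ≡ 1` torus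
MODEL; one finite T⁴ at fixed ε — NOT infinite volume, NOT OS on ℝ⁴, NOT a mass gap, NOT Clay.
-/

noncomputable section

open scoped BigOperators
open Finset

namespace Summit.QuantumFields.YangMills.BalabanUVNodes.N15.TwoGrid

open Literature.MathematicalPhysics.QuantumFieldTheory.Balaban1983to89
open Literature.MathematicalPhysics.QuantumFieldTheory.Balaban1983to89.T4EtaRateDefect (idef idef_apply idef_comp)
open Literature.MathematicalPhysics.QuantumFieldTheory.Balaban1983to89.T4EtaRateCoeffDefect (pull pull_apply)
open Literature.MathematicalPhysics.QuantumFieldTheory.Balaban1983to89.B5Prop11Plancherel (Tor fine unitVec)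
open Summit.QuantumFields.YangMills.BalabanUVNodes.N15.VectorPiece (kingPr kingPrV kingPr_val kingPrV_eq floorMap_add_unitVec)

variable {d : ℕ}

/-! ## §1 Translations of fine 1-forms and the symbol map -/

section Symbols

variable (M : Fin (d + 1) → ℕ) (n : ℕ)

/-- TRANSLATION of level-`n` fine 1-forms in the site argument: `(τ_v f)(x, a) = f(x + v, a)` (the bond direction `a` is passive). [cite: Balaban1984PropagatorsI, (1.21) p.21 (lattice shifts behind the difference quotients)] -/
def tshiftV (v : Tor (fine n M)) : (Tor (fine n M) × Fin (d + 1) → ℝ) →ₗ[ℝ] (Tor (fine n M) × Fin (d + 1) → ℝ) :=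
  pull fun i : Tor (fine n M) × Fin (d + 1) => (i.1 + v, i.2)

/-- Pointwise form of the translation. [folklore] -/
@[simp] theorem tshiftV_apply (v : Tor (fine n M)) (f : Tor (fine n M) × Fin (d + 1) → ℝ) (i : Tor (fine n M) × Fin (d + 1)) :
    tshiftV M n v f i = f (i.1 + v, i.2) := rfl

/-- The translations as a monoid homomorphism from (the multiplicative copy of) the fine torus `T = Π_μ ℤ∕(nM_μ)` into the endomorphisms of fine 1-forms
(`τ_0 = 1`, `τ_{v+w} = τ_v τ_w`). [folklore] -/
def transRep : Multiplicative (Tor (fine n M)) →* Module.End ℝ (Tor (fine n M) × Fin (d + 1) → ℝ) where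
  toFun v := tshiftV M n (Multiplicative.toAdd v)
  map_one' := LinearMap.ext fun f => funext fun i => by simp
  map_mul' v w := LinearMap.ext fun f => funext fun i => by simp [add_assoc]

/-- **THE SYMBOL MAP** `ρ : ℝ[T] →ₐ[ℝ] End`: the (commutative) group algebra of the fine torus acts on fine 1-forms by translations
(`AddMonoidAlgebra.lift` of `transRep`) — every translation-built lattice operator below is `ρ` of a symbol, and products of symbols commute. [folklore] -/
def symbOp : AddMonoidAlgebra ℝ (Tor (fine n M)) →ₐ[ℝ] Module.End ℝ (Tor (fine n M) × Fin (d + 1) → ℝ) :=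
  AddMonoidAlgebra.lift ℝ (Module.End ℝ (Tor (fine n M) × Fin (d + 1) → ℝ)) (Tor (fine n M)) (transRep M n)

/-- `ρ(c·[v]) = c·τ_v`. [folklore] -/
theorem symbOp_single (v : Tor (fine n M)) (c : ℝ) :
    symbOp M n (AddMonoidAlgebra.single v c) = c • tshiftV M n v := by
  rw [symbOp, AddMonoidAlgebra.lift_single]
  rfl

/-- `(ρ(c·[v]) f)(x, a) = c·f(x + v, a)`. [folklore] -/
theorem symbOp_single_apply (v : Tor (fine n M)) (c : ℝ) (f : Tor (fine n M) × Fin (d + 1) → ℝ) (i : Tor (fine n M) × Fin (d + 1)) :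
    symbOp M n (AddMonoidAlgebra.single v c) f i = c * f (i.1 + v, i.2) := by
  rw [symbOp_single]
  rfl

/-! ## §2 The symbols of the shift, the box filter, the partial sums and the difference quotient; their exact algebra -/

/-- the SHIFT SYMBOL `s_κ = [e_κ]` (translation by one fine lattice step in direction `κ`). [folklore] -/
def sT (κ : Fin (d + 1)) : AddMonoidAlgebra ℝ (Tor (fine n M)) := AddMonoidAlgebra.single (unitVec (fine n M) κ) 1

/-- the BOX-FILTER SYMBOL `a_κ = R⁻¹ Σ_{j<R} s_κ^j` (the average over `R` consecutive fine steps in direction `κ` — one COARSE step when `R = L^m`;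
the one-axis line average, cf. the tree's pointwise `NE3LineAverage.lineAvg` ∕ `RegularTowerSubdivision.boxAvg`). [folklore] -/
def sA (κ : Fin (d + 1)) (R : ℕ) : AddMonoidAlgebra ℝ (Tor (fine n M)) := (R : ℝ)⁻¹ • ∑ j ∈ range R, sT M n κ ^ j

/-- the PARTIAL-SUM SYMBOL `b̃_κ = Σ_{j<R} Σ_{i<j} s_κ^i` (so that `1 − a_κ = −R⁻¹(s_κ − 1)b̃_κ`). [folklore] -/
def sBt (κ : Fin (d + 1)) (R : ℕ) : AddMonoidAlgebra ℝ (Tor (fine n M)) := ∑ j ∈ range R, ∑ i ∈ range j, sT M n κ ^ i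

/-- the DIFFERENCE-QUOTIENT SYMBOL `c·(s_κ − 1)` (forward difference with lattice factor `c`; `c = η⁻¹` gives [B5]'s `∂_κ` of (1.21)∕(1.31)). [cite: Balaban1984PropagatorsI, (1.31) p.23 (forward difference quotient)] -/
def sD (κ : Fin (d + 1)) (c : ℝ) : AddMonoidAlgebra ℝ (Tor (fine n M)) := c • (sT M n κ - 1)

/-- the SMOOTHING SYMBOL `Π_ν a_ν²` (the box filter applied twice in every direction — the mask of the twice-refined degree-one box spline; `ρ` of it
composed with King's prolongation is the conforming transport `P̂₂`, cf. the tree's pointwise `RegularTowerSubdivision.subdiv`). [folklore] -/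
def sSm (R : ℕ) : AddMonoidAlgebra ℝ (Tor (fine n M)) := ∏ ν : Fin (d + 1), sA M n ν R ^ 2

/-- the SWAP SYMBOLS `h⁰_ν = −(cR)⁻¹·b̃_ν(1 + a_ν)Π_{ν′<ν}a_{ν′}²` of the divergence form `1 − Π_νa_ν² = Σ_ν c(s_ν − 1)·h⁰_ν`. [folklore] -/
def sH (R : ℕ) (c : ℝ) (ν : Fin (d + 1)) : AddMonoidAlgebra ℝ (Tor (fine n M)) :=
  -((c * R)⁻¹ • (sBt M n ν R * (1 + sA M n ν R) * ∏ ν' ∈ univ.filter (· < ν), sA M n ν' R ^ 2))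

/-- Powers of the shift symbol: `s_κ^j = [j e_κ]`. [folklore] -/
theorem sT_pow (κ : Fin (d + 1)) (j : ℕ) : sT M n κ ^ j = AddMonoidAlgebra.single (j • unitVec (fine n M) κ) 1 := by
  rw [sT, AddMonoidAlgebra.single_pow, one_pow]

/-- TELESCOPING: `(s_κ − 1)·Σ_{j<R} s_κ^j = s_κ^R − 1`. [folklore] -/
theorem sT_sub_one_mul_sum (κ : Fin (d + 1)) (R : ℕ) :
    (sT M n κ - 1) * ∑ j ∈ range R, sT M n κ ^ j = sT M n κ ^ R - 1 :=
  mul_geom_sum _ _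

/-- **`∂′·A = D^η`**: `c(s_κ − 1)·a_κ = (cR⁻¹)·(s_κ^R − 1)` — the fine difference quotient of the box filter IS the coarse-step difference quotient
(lattice factor `c∕R`). [folklore] -/
theorem sD_mul_sA (κ : Fin (d + 1)) (c : ℝ) (R : ℕ) :
    sD M n κ c * sA M n κ R = (c * (R : ℝ)⁻¹) • (sT M n κ ^ R - 1) := by
  rw [sD, sA, smul_mul_smul_comm, sT_sub_one_mul_sum, mul_smul]

/-- **`1 − a_κ = −R⁻¹(s_κ − 1)b̃_κ`** (`R ≠ 0`): the filter defect is a fine difference of the partial sums. [folklore] -/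
theorem one_sub_sA (κ : Fin (d + 1)) {R : ℕ} (hR : R ≠ 0) :
    1 - sA M n κ R = -((R : ℝ)⁻¹ • ((sT M n κ - 1) * sBt M n κ R)) := by
  have hR' : (R : ℝ) ≠ 0 := Nat.cast_ne_zero.mpr hR
  have hsum : (sT M n κ - 1) * sBt M n κ R = (∑ j ∈ range R, sT M n κ ^ j) - R • (1 : AddMonoidAlgebra ℝ (Tor (fine n M))) := by
    rw [sBt, mul_sum, sum_congr rfl fun j _ => sT_sub_one_mul_sum M n κ j, sum_sub_distrib, sum_const, card_range]
  rw [hsum, smul_sub, sA, neg_sub]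
  congr 1
  rw [← Nat.cast_smul_eq_nsmul ℝ, smul_smul, inv_mul_cancel₀ hR', one_smul]

/-- `1 − a_κ² = [c(s_κ − 1)]·[−(cR)⁻¹ b̃_κ(1 + a_κ)]` (`R ≠ 0`, `c ≠ 0`). [folklore] -/
theorem one_sub_sA_sq (κ : Fin (d + 1)) {R : ℕ} (hR : R ≠ 0) {c : ℝ} (hc : c ≠ 0) :
    1 - sA M n κ R ^ 2 = sD M n κ c * (-((c * R)⁻¹ • (sBt M n κ R * (1 + sA M n κ R)))) := by
  have h : 1 - sA M n κ R ^ 2 = (1 - sA M n κ R) * (1 + sA M n κ R) := by ring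
  have hcR : c * (c * (R : ℝ))⁻¹ = (R : ℝ)⁻¹ := by rw [mul_inv, ← mul_assoc, mul_inv_cancel₀ hc, one_mul]
  rw [h, one_sub_sA M n κ hR, sD, mul_neg, neg_mul, smul_mul_smul_comm, smul_mul_assoc, mul_assoc, hcR]

/-- **THE SWAP COST IN DIVERGENCE FORM (symbols)**: `1 − Π_νa_ν² = Σ_ν c(s_ν − 1)·h⁰_ν` — the ordered telescoping `Finset.prod_one_sub_ordered` over the
directions, then `one_sub_sA_sq` per direction. [folklore] -/
theorem one_sub_sSm (R : ℕ) (hR : R ≠ 0) {c : ℝ} (hc : c ≠ 0) :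
    1 - sSm M n R = ∑ ν : Fin (d + 1), sD M n ν c * sH M n R c ν := by
  have htel := prod_one_sub_ordered (univ : Finset (Fin (d + 1))) fun ν => 1 - sA M n ν R ^ 2
  simp only [sub_sub_cancel] at htel
  rw [sSm, htel, sub_sub_cancel]
  refine sum_congr rfl fun ν _ => ?_
  rw [one_sub_sA_sq M n ν hR hc, sH, mul_assoc]
  congr 1
  rw [neg_mul, smul_mul_assoc]

/-- PEELING one direction off the smoothing symbol: `c(s_κ − 1)·Π_νa_ν² = (a_κΠ_{ν≠κ}a_ν²)·(c(s_κ − 1)a_κ)`. [folklore] -/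
theorem sD_mul_sSm (κ : Fin (d + 1)) (c : ℝ) (R : ℕ) :
    sD M n κ c * sSm M n R = (sA M n κ R * ∏ ν ∈ univ.erase κ, sA M n ν R ^ 2) * (sD M n κ c * sA M n κ R) := by
  rw [sSm, ← mul_prod_erase univ (fun ν => sA M n ν R ^ 2) (mem_univ κ)]
  ring

/-! ## §3 The operators: pointwise forms -/

/-- The shift operator, pointwise: `(ρ(s_κ)f)(x, a) = f(x + e_κ, a)`. [folklore] -/
theorem symbOp_sT_apply (κ : Fin (d + 1)) (f : Tor (fine n M) × Fin (d + 1) → ℝ) (i : Tor (fine n M) × Fin (d + 1)) :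
    symbOp M n (sT M n κ) f i = f (i.1 + unitVec (fine n M) κ, i.2) := by
  rw [sT, symbOp_single_apply, one_mul]

/-- Iterated shifts, pointwise: `(ρ(s_κ^j)f)(x, a) = f(x + je_κ, a)`. [folklore] -/
theorem symbOp_sT_pow_apply (κ : Fin (d + 1)) (j : ℕ) (f : Tor (fine n M) × Fin (d + 1) → ℝ) (i : Tor (fine n M) × Fin (d + 1)) :
    symbOp M n (sT M n κ ^ j) f i = f (i.1 + j • unitVec (fine n M) κ, i.2) := by
  rw [sT_pow, symbOp_single_apply, one_mul]

/-- THE BOX FILTER, pointwise: `(A_κf)(x, a) = R⁻¹Σ_{j<R} f(x + je_κ, a)`. [folklore] -/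
theorem symbOp_sA_apply (κ : Fin (d + 1)) (R : ℕ) (f : Tor (fine n M) × Fin (d + 1) → ℝ) (i : Tor (fine n M) × Fin (d + 1)) :
    symbOp M n (sA M n κ R) f i = (R : ℝ)⁻¹ * ∑ j ∈ range R, f (i.1 + j • unitVec (fine n M) κ, i.2) := by
  rw [sA, map_smul, map_sum, LinearMap.smul_apply, LinearMap.sum_apply, Pi.smul_apply, Finset.sum_apply, smul_eq_mul]
  congr 1
  exact sum_congr rfl fun j _ => symbOp_sT_pow_apply M n κ j f i

/-- THE FORWARD DIFFERENCE QUOTIENT, pointwise: `(ρ(c(s_κ − 1))f)(x, a) = c·(f(x + e_κ, a) − f(x, a))` — at `c = n = η⁻¹` this is `(∇_κ f)_a(x)` of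
[B5] (1.21)∕(1.31) (the site action of `B5Prop11Plancherel.fdiff`, cf. part 15's `reD`). [cite: Balaban1984PropagatorsI, (1.31) p.23] -/
theorem symbOp_sD_apply (κ : Fin (d + 1)) (c : ℝ) (f : Tor (fine n M) × Fin (d + 1) → ℝ) (i : Tor (fine n M) × Fin (d + 1)) :
    symbOp M n (sD M n κ c) f i = c * (f (i.1 + unitVec (fine n M) κ, i.2) - f i) := by
  rw [sD, map_smul, map_sub, map_one, LinearMap.smul_apply, LinearMap.sub_apply, Pi.smul_apply, Pi.sub_apply, smul_eq_mul,
    symbOp_sT_apply]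
  rfl

end Symbols

/-! ## §4 Sup-norm bounds: the filter averages, the partial sums are `O(R)`, the swap fields `H⁰_ν λ` are `O(η)` -/

section Bounds

variable (M : Fin (d + 1) → ℕ) [∀ μ, NeZero (M μ)] (n : ℕ) [NeZero n]

/-- Translations do not increase the sup norm. [folklore] -/
theorem norm_tshiftV_le (v : Tor (fine n M)) (f : Tor (fine n M) × Fin (d + 1) → ℝ) : ‖tshiftV M n v f‖ ≤ ‖f‖ := by
  refine (pi_norm_le_iff_of_nonneg (norm_nonneg f)).mpr fun i => ?_
  rw [tshiftV_apply]
  exact norm_le_pi_norm f _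

/-- Pull-backs do not increase the sup norm. [folklore] -/
theorem norm_pull_le {X X' : Type} [Fintype X] [Fintype X'] (π : X' → X) (g : X → ℝ) : ‖pull π g‖ ≤ ‖g‖ := by
  refine (pi_norm_le_iff_of_nonneg (norm_nonneg g)).mpr fun x' => ?_
  rw [pull_apply]
  exact norm_le_pi_norm g _

/-- `‖ρ(s_κ^j)f‖ ≤ ‖f‖`. [folklore] -/
theorem norm_symbOp_sT_pow_le (κ : Fin (d + 1)) (j : ℕ) (f : Tor (fine n M) × Fin (d + 1) → ℝ) :
    ‖symbOp M n (sT M n κ ^ j) f‖ ≤ ‖f‖ := by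
  rw [sT_pow, symbOp_single, one_smul]
  exact norm_tshiftV_le M n _ f

/-- THE BOX FILTER IS A SUP-NORM CONTRACTION: `‖A_κf‖ ≤ ‖f‖` (`R ≠ 0`). [folklore] -/
theorem norm_symbOp_sA_le (κ : Fin (d + 1)) {R : ℕ} (hR : R ≠ 0) (f : Tor (fine n M) × Fin (d + 1) → ℝ) :
    ‖symbOp M n (sA M n κ R) f‖ ≤ ‖f‖ := by
  have hR' : (0 : ℝ) < R := by exact_mod_cast Nat.pos_of_ne_zero hR
  rw [sA, map_smul, map_sum, LinearMap.smul_apply, LinearMap.sum_apply, norm_smul, norm_inv, Real.norm_natCast]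
  calc (R : ℝ)⁻¹ * ‖∑ j ∈ range R, symbOp M n (sT M n κ ^ j) f‖ ≤ (R : ℝ)⁻¹ * ∑ j ∈ range R, ‖symbOp M n (sT M n κ ^ j) f‖ := by
        gcongr; exact norm_sum_le _ _
    _ ≤ (R : ℝ)⁻¹ * ∑ j ∈ range R, ‖f‖ := by gcongr with j _; exact norm_symbOp_sT_pow_le M n κ j f
    _ = ‖f‖ := by rw [sum_const, card_range, nsmul_eq_mul, ← mul_assoc, inv_mul_cancel₀ hR'.ne', one_mul]

/-- `‖(1 + A_κ)f‖ ≤ 2‖f‖`. [folklore] -/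
theorem norm_symbOp_one_add_sA_le (κ : Fin (d + 1)) {R : ℕ} (hR : R ≠ 0) (f : Tor (fine n M) × Fin (d + 1) → ℝ) :
    ‖symbOp M n (1 + sA M n κ R) f‖ ≤ 2 * ‖f‖ := by
  rw [map_add, map_one, LinearMap.add_apply, Module.End.one_apply, two_mul]
  exact (norm_add_le _ _).trans (add_le_add le_rfl (norm_symbOp_sA_le M n κ hR f))

/-- Gauss: `Σ_{j<R} j = R(R − 1)∕2` (as reals). [folklore] -/
theorem sum_range_cast_eq (R : ℕ) : ∑ j ∈ range R, (j : ℝ) = (R : ℝ) * ((R : ℝ) - 1) / 2 := by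
  induction R with
  | zero => simp
  | succ R ih => rw [sum_range_succ, ih]; push_cast; ring

/-- THE PARTIAL SUMS ARE `O(R²)`: `‖B̃_κf‖ ≤ (R(R − 1)∕2)·‖f‖`. [folklore] -/
theorem norm_symbOp_sBt_le (κ : Fin (d + 1)) (R : ℕ) (f : Tor (fine n M) × Fin (d + 1) → ℝ) :
    ‖symbOp M n (sBt M n κ R) f‖ ≤ ((R : ℝ) * ((R : ℝ) - 1) / 2) * ‖f‖ := by
  rw [sBt, map_sum, LinearMap.sum_apply, ← sum_range_cast_eq, sum_mul]
  refine (norm_sum_le _ _).trans (sum_le_sum fun j _ => ?_)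
  rw [map_sum, LinearMap.sum_apply]
  refine (norm_sum_le _ _).trans ?_
  calc ∑ l ∈ range j, ‖symbOp M n (sT M n κ ^ l) f‖ ≤ ∑ l ∈ range j, ‖f‖ := sum_le_sum fun l _ => norm_symbOp_sT_pow_le M n κ l f
    _ = (j : ℝ) * ‖f‖ := by rw [sum_const, card_range, nsmul_eq_mul]

/-- THE SMOOTHING IS A SUP-NORM CONTRACTION: `‖ρ(Π_{ν∈s}a_ν²)f‖ ≤ ‖f‖` (`R ≠ 0`). [folklore] -/
theorem norm_symbOp_prod_sA_sq_le {R : ℕ} (hR : R ≠ 0) (s : Finset (Fin (d + 1))) (f : Tor (fine n M) × Fin (d + 1) → ℝ) :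
    ‖symbOp M n (∏ ν ∈ s, sA M n ν R ^ 2) f‖ ≤ ‖f‖ := by
  classical
  induction s using Finset.induction_on generalizing f with
  | empty => rw [prod_empty, map_one, Module.End.one_apply]
  | insert ν s hν ih =>
      rw [prod_insert hν, map_mul, Module.End.mul_apply, pow_two, map_mul, Module.End.mul_apply]
      exact (norm_symbOp_sA_le M n ν hR _).trans ((norm_symbOp_sA_le M n ν hR _).trans (ih _))

/-- **THE SWAP OPERATORS ARE `O(R∕c)`**: `‖ρ(h⁰_ν)f‖ ≤ ((R − 1)∕c)·‖f‖` (`R ≠ 0`, `c > 0`): `(cR)⁻¹ × R(R − 1)∕2 × 2 × 1`. [folklore] -/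
theorem norm_symbOp_sH_le {R : ℕ} (hR : R ≠ 0) {c : ℝ} (hc : 0 < c) (ν : Fin (d + 1)) (f : Tor (fine n M) × Fin (d + 1) → ℝ) :
    ‖symbOp M n (sH M n R c ν) f‖ ≤ (((R : ℝ) - 1) / c) * ‖f‖ := by
  have hR' : (0 : ℝ) < R := by exact_mod_cast Nat.pos_of_ne_zero hR
  have hR1 : (0 : ℝ) ≤ (R : ℝ) - 1 := by
    have : (1 : ℝ) ≤ R := by exact_mod_cast Nat.pos_of_ne_zero hR
    linarith
  rw [sH, map_neg, LinearMap.neg_apply, norm_neg, map_smul, LinearMap.smul_apply, norm_smul, map_mul, map_mul, Module.End.mul_apply,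
    Module.End.mul_apply, norm_inv, norm_mul, Real.norm_of_nonneg hc.le, Real.norm_natCast]
  set g := symbOp M n (∏ ν' ∈ univ.filter (· < ν), sA M n ν' R ^ 2) f with hg
  have h1 : ‖g‖ ≤ ‖f‖ := norm_symbOp_prod_sA_sq_le M n hR _ f
  have h2 : ‖symbOp M n (1 + sA M n ν R) g‖ ≤ 2 * ‖f‖ := (norm_symbOp_one_add_sA_le M n ν hR g).trans (by linarith)
  have h3 := norm_symbOp_sBt_le M n ν R (symbOp M n (1 + sA M n ν R) g)
  have hRR : 0 ≤ (R : ℝ) * ((R : ℝ) - 1) / 2 := by positivity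
  calc (c * R)⁻¹ * ‖symbOp M n (sBt M n ν R) (symbOp M n (1 + sA M n ν R) g)‖
      ≤ (c * R)⁻¹ * (((R : ℝ) * ((R : ℝ) - 1) / 2) * (2 * ‖f‖)) := by
        gcongr
        exact h3.trans (mul_le_mul_of_nonneg_left h2 hRR)
    _ = (((R : ℝ) - 1) / c) * ‖f‖ := by field_simp

end Bounds

/-! ## §5 King's pairing: the exact intertwinings of the two-grid transport -/

section Pairing

variable {A B : Fin (d + 1) → ℕ} [∀ μ, NeZero (A μ)] [∀ μ, NeZero (B μ)]

/-- **`R` LATTICE STEPS UNDER A COORDINATEWISE FLOOR MAP CROSS EXACTLY ONE BLOCK FACE**: if `φ : Πℤ∕A_μ → Πℤ∕B_μ` reads `⌊·∕R⌋` on residues and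
`A_μ = R·B_μ`, then `φ(z + Re_κ) = φz + e_κ` (`R` applications of n15-c's `floorMap_add_unitVec`, done in one residue computation; the wrap-around
`A_κ ≡ 0` is invisible modulo `B_κ`). [cite: King1986, p.664 (pairing convention «x′ ∈ B^n(x)», blocks as floors)] -/
theorem floorMap_add_smul_unitVec {R : ℕ} (hR : R ≠ 0) (φ : Tor A → Tor B) (hφ : ∀ x μ, (φ x μ).val = (x μ).val / R)
    (hAB : ∀ μ, A μ = R * B μ) (z : Tor A) (κ : Fin (d + 1)) :
    φ (z + R • unitVec A κ) = φ z + unitVec B κ := by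
  have hoff : ∀ μ, μ ≠ κ → φ (z + R • unitVec A κ) μ = φ z μ := fun μ hμ => by
    apply ZMod.val_injective
    rw [hφ, hφ, show (z + R • unitVec A κ) μ = z μ by simp [unitVec, hμ]]
  have hφz : φ z κ = (((z κ).val / R : ℕ) : ZMod (B κ)) := by rw [← hφ, ZMod.natCast_zmod_val]
  have hon : φ (z + R • unitVec A κ) κ = (((z κ).val / R : ℕ) : ZMod (B κ)) + 1 := by
    have hstep : (z + R • unitVec A κ) κ = z κ + (R : ZMod (A κ)) := by simp [unitVec]
    have hval : ((z + R • unitVec A κ) κ).val = ((z κ).val + R) % A κ := by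
      rw [hstep, ZMod.val_add, ZMod.val_natCast, Nat.add_mod_mod]
    have hmod : ((z κ).val + R) % A κ / R = ((z κ).val / R + 1) % B κ := by
      rw [congrArg (fun t => ((z κ).val + R) % t / R) (hAB κ), Nat.mod_mul_right_div_self, Nat.add_div_right _ (Nat.pos_of_ne_zero hR)]
    calc φ (z + R • unitVec A κ) κ = (((φ (z + R • unitVec A κ) κ).val : ℕ) : ZMod (B κ)) := (ZMod.natCast_zmod_val _).symm
      _ = ((((z κ).val / R + 1) % B κ : ℕ) : ZMod (B κ)) := by rw [hφ, hval, hmod]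
      _ = _ := by rw [ZMod.natCast_mod]; push_cast; ring
  funext μ
  by_cases hμ : μ = κ
  · subst hμ
    rw [Pi.add_apply, hon, hφz]
    simp [unitVec]
  · rw [Pi.add_apply, hoff μ hμ, show unitVec B κ μ = 0 by simp [unitVec, hμ], add_zero]

variable (M : Fin (d + 1) → ℕ) [∀ μ, NeZero (M μ)] (L k m : ℕ) [NeZero L]

/-- KING's PAIRING OF A COARSE-STEPPED FINE POINT: `pr(z + L^me′_κ) = pr z + e_κ` — `L^m` fine steps are one coarse step (the b2b∕t4 cell's
`BlockPairingGeometry.par_add_tstep_self` in the N15 lineage's names). [cite: King1986, p.664 (pairing convention «x′ ∈ B^n(x)»)] -/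
theorem kingPr_add_smul_unitVec (z : Tor (fine (L ^ m * L ^ k) M)) (κ : Fin (d + 1)) :
    kingPr L k m M (z + L ^ m • unitVec (fine (L ^ m * L ^ k) M) κ) = kingPr L k m M z + unitVec (fine (L ^ k) M) κ :=
  floorMap_add_smul_unitVec (pow_ne_zero m (NeZero.ne L)) (kingPr L k m M) (fun x μ => kingPr_val L k m M x μ)
    (fun _ => Nat.mul_assoc _ _ _) z κ

omit [∀ μ, NeZero (M μ)] [NeZero L] in
/-- DICTIONARY (`rfl`): King's pairing of fine points of the N15 lineage IS the block parent `par` of the b2b∕t4 cell's `BalabanAveragedTowerModes` at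
`N = L^k`, `R = L^m`. [cite: King1986, p.664 (pairing convention «x′ ∈ B^n(x)»)] -/
theorem kingPr_eq_par : kingPr L k m M = Summit.QuantumFields.BalabanUV.T4Continuum.BalabanAveragedTowerModes.par (L ^ k) (L ^ m) M := rfl

omit [∀ μ, NeZero (M μ)] [NeZero L] in
/-- DICTIONARY (`rfl`): King's pairing of fine BONDS IS `BlockPairingGeometry.parT` at `N = L^k`, `R = L^m`. [cite: King1986, p.664 (pairing convention)] -/
theorem kingPrV_eq_parT : kingPrV L k m M = Summit.QuantumFields.BalabanUV.T4Continuum.BlockPairingGeometry.parT (L ^ k) (L ^ m) M := rfl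

/-- **COARSE TRANSLATIONS THROUGH THE PROLONGATION**: `τ′_{L^me′_κ} ∘ P = P ∘ τ_{e_κ}` for King's piecewise-constant prolongation `P = pull kingPrV` of coarse
1-forms to the `η′ = L^{−m}η` lattice. [cite: King1986, p.664 (pairing convention)] -/
theorem symbOp_sT_pow_comp_pull (κ : Fin (d + 1)) :
    symbOp M (L ^ m * L ^ k) (sT M (L ^ m * L ^ k) κ ^ L ^ m) ∘ₗ pull (kingPrV L k m M) =
      pull (kingPrV L k m M) ∘ₗ symbOp M (L ^ k) (sT M (L ^ k) κ) := by
  refine LinearMap.ext fun g => funext fun i => ?_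
  rw [LinearMap.comp_apply, LinearMap.comp_apply, symbOp_sT_pow_apply, pull_apply, pull_apply, symbOp_sT_apply, kingPrV_eq, kingPrV_eq,
    kingPr_add_smul_unitVec]

/-- ★ **`∂′_κA_κP = P∂_κ`**: the fine difference quotient (lattice factor `c·L^m`) of the box-filtered prolongation IS the prolongation of the coarse
difference quotient (factor `c`) — no block-face dipoles (`sD_mul_sA` transported by `symbOp`, then `symbOp_sT_pow_comp_pull`). [folklore] -/
theorem symbOp_sD_sA_comp_pull (κ : Fin (d + 1)) (c : ℝ) :
    symbOp M (L ^ m * L ^ k) (sD M (L ^ m * L ^ k) κ (c * L ^ m)) ∘ₗ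
        (symbOp M (L ^ m * L ^ k) (sA M (L ^ m * L ^ k) κ (L ^ m)) ∘ₗ pull (kingPrV L k m M)) =
      pull (kingPrV L k m M) ∘ₗ symbOp M (L ^ k) (sD M (L ^ k) κ c) := by
  have hLm : ((L : ℝ) ^ m) ≠ 0 := pow_ne_zero m (Nat.cast_ne_zero.mpr (NeZero.ne L))
  rw [← LinearMap.comp_assoc, ← Module.End.mul_eq_comp, ← map_mul, sD_mul_sA, Nat.cast_pow, mul_assoc, mul_inv_cancel₀ hLm, mul_one,
    map_smul, map_sub, map_one, LinearMap.smul_comp, LinearMap.sub_comp, Module.End.one_eq_id, LinearMap.id_comp,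
    symbOp_sT_pow_comp_pull, sD, map_smul, map_sub, map_one, LinearMap.comp_smul, LinearMap.comp_sub, Module.End.one_eq_id,
    LinearMap.comp_id]

/-- ★ **`∂′_κP̂₂ = (A_κΠ_{ν≠κ}A_ν²)·P∂_κ`** for the SMOOTHED (conforming) PROLONGATION `P̂₂ = ρ(Π_νa_ν²)∘P`: the fine gradient of `P̂₂u` is a
box-filtered prolongation of the coarse gradient of `u` — once more filterable in direction `κ`, which is what the fine Laplacian needs (sequel R2).
[folklore] -/
theorem symbOp_sD_sSm_comp_pull (κ : Fin (d + 1)) (c : ℝ) :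
    symbOp M (L ^ m * L ^ k) (sD M (L ^ m * L ^ k) κ (c * L ^ m)) ∘ₗ
        (symbOp M (L ^ m * L ^ k) (sSm M (L ^ m * L ^ k) (L ^ m)) ∘ₗ pull (kingPrV L k m M)) =
      symbOp M (L ^ m * L ^ k) (sA M (L ^ m * L ^ k) κ (L ^ m) * ∏ ν ∈ univ.erase κ, sA M (L ^ m * L ^ k) ν (L ^ m) ^ 2) ∘ₗ
        (pull (kingPrV L k m M) ∘ₗ symbOp M (L ^ k) (sD M (L ^ k) κ c)) := by
  rw [← LinearMap.comp_assoc, ← Module.End.mul_eq_comp, ← map_mul, sD_mul_sSm, map_mul,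
    map_mul (symbOp M (L ^ m * L ^ k)) (sD M (L ^ m * L ^ k) κ (c * L ^ m)), Module.End.mul_eq_comp, Module.End.mul_eq_comp,
    LinearMap.comp_assoc, LinearMap.comp_assoc, symbOp_sD_sA_comp_pull M L k m κ c]

omit [∀ μ, NeZero (M μ)] in
/-- ★ **THE SWAP COST IN DIVERGENCE FORM**: `P − P̂₂ = (Σ_ν ∂′_ν·ρ(h⁰_ν))∘P` with `∂′_ν = ρ(c(s_ν − 1))` for ANY lattice factor `c ≠ 0` (the natural one is
`c = η′⁻¹ = L^kL^m`) — replacing King's prolongation by the conforming one inside `G′(·)` costs a fine DIVERGENCE of the `O(η)`-small fields `H⁰_νλ`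
(`norm_symbOp_sH_pull_le`), the shape the printed entry «G∇*J» of [B5] (1.110) consumes. [cite: Balaban1984PropagatorsI, Prop. 1.2 (1.110) p.34 (the consumer's shape, not used here)] -/
theorem pull_sub_sSm_comp_pull {c : ℝ} (hc : c ≠ 0) :
    pull (kingPrV L k m M) - symbOp M (L ^ m * L ^ k) (sSm M (L ^ m * L ^ k) (L ^ m)) ∘ₗ pull (kingPrV L k m M) =
      (∑ ν : Fin (d + 1), symbOp M (L ^ m * L ^ k) (sD M (L ^ m * L ^ k) ν c) * symbOp M (L ^ m * L ^ k) (sH M (L ^ m * L ^ k) (L ^ m) c ν)) ∘ₗ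
        pull (kingPrV L k m M) := by
  rw [show pull (kingPrV L k m M) - symbOp M (L ^ m * L ^ k) (sSm M (L ^ m * L ^ k) (L ^ m)) ∘ₗ pull (kingPrV L k m M) =
      ((1 : Module.End ℝ (Tor (fine (L ^ m * L ^ k) M) × Fin (d + 1) → ℝ)) - symbOp M (L ^ m * L ^ k) (sSm M (L ^ m * L ^ k) (L ^ m))) ∘ₗ
        pull (kingPrV L k m M) by rw [LinearMap.sub_comp, Module.End.one_eq_id, LinearMap.id_comp],
    ← map_one (symbOp M (L ^ m * L ^ k)), ← map_sub, one_sub_sSm M (L ^ m * L ^ k) (L ^ m) (pow_ne_zero m (NeZero.ne L)) hc, map_sum]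
  congr 1
  exact sum_congr rfl fun ν _ => map_mul _ _ _

/-- ★ **THE SWAP FIELDS ARE `O(η)`**: with the fine lattice factor `c = L^kL^m = η′⁻¹` and `R = L^m`, `‖H⁰_νλ‖ = ‖ρ(h⁰_ν)(Pλ)‖ ≤ L^{−k}·‖λ‖_∞ = η·‖λ‖_∞`
— uniformly in `m`, the torus and the direction. [folklore] -/
theorem norm_symbOp_sH_pull_le (ν : Fin (d + 1)) (g : Tor (fine (L ^ k) M) × Fin (d + 1) → ℝ) :
    ‖symbOp M (L ^ m * L ^ k) (sH M (L ^ m * L ^ k) (L ^ m) ((L : ℝ) ^ k * (L : ℝ) ^ m) ν) (pull (kingPrV L k m M) g)‖ ≤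
      ((L : ℝ) ^ k)⁻¹ * ‖g‖ := by
  have hL : (0 : ℝ) < L := by exact_mod_cast Nat.pos_of_ne_zero (NeZero.ne L)
  have hLk : (0 : ℝ) < (L : ℝ) ^ k := pow_pos hL k
  have hLm : (0 : ℝ) < (L : ℝ) ^ m := pow_pos hL m
  refine (norm_symbOp_sH_le M (L ^ m * L ^ k) (pow_ne_zero m (NeZero.ne L)) (mul_pos hLk hLm) ν _).trans ?_
  refine (mul_le_mul_of_nonneg_left (norm_pull_le (kingPrV L k m M) g) (div_nonneg ?_ (mul_pos hLk hLm).le)).trans ?_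
  · rw [Nat.cast_pow, sub_nonneg]
    exact one_le_pow₀ (by exact_mod_cast Nat.pos_of_ne_zero (NeZero.ne L))
  · refine mul_le_mul_of_nonneg_right ?_ (norm_nonneg g)
    rw [Nat.cast_pow, div_le_iff₀ (mul_pos hLk hLm), ← mul_assoc, inv_mul_cancel₀ hLk.ne', one_mul]
    linarith

end Pairing


end Summit.QuantumFields.YangMills.BalabanUVNodes.N15.TwoGrid
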